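import Summits.BirchSwinnertonDyer.BirchSwinnertonDyer.Theorems.GoldfeldAllTwistsTwoConverseTwinQuarterTracePartnerPackageE
import HarnessLib

set_option linter.dupNamespace false -- namespace `…BirchSwinnertonDyer.BirchSwinnertonDyer…` is the cell's (D-0017 nested layout)
set_option autoImplicit false

/-!
# LINE B⁗, file X3b-1: GENUS TRANSPORT — how an automorphism of `K[1]` acts on a point that comes from the PARTNER FIELD's Hilbert
# class field `F[1]` through the common biquadratic subfield (the one new mechanism of the χ_e signature, memo B4-SIGNATURES §4 X3)

Cell `bsd-goldfeld`, seat `bsd-goldfeld-s1p-c3x` (gen 10); planner ORDER (ccxcix) TRANCHE 2, object X3 (β `χ_e` half, part 1: transport lemmas).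
`--supports stmt-BirchSwinnertonDyer-19140` as a HELPER (twin″). Theses-free, print-free; theorems only; no definition, no `sorry`, no new fact.

THE PROBLEM. A2a″'s `χ_e` package builds `R_e = u•Φ − 2v•Y′` from the half trace `Φ ∈ X₀(49)(F[1])` of the partner field `F = ℚ(√−qp) ⊂ K[1]`
(`F[1] = ringClassField F ι_F 1 ⊂ ℂ`, NOT a subfield of `K[1]`); `Φ` is fixed by `Gal(F[1]/F(r′))` (`r′² = p`), so its complex image lies in
the genus subgroup `B` and has a preimage `Φ^L ∈ X₀(49)(K[1])`. The χ_Z core needs `σ̃Φ^L` for `σ̃ ∈ Gal(K[1]/K)`; nothing in the tree moves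
an automorphism between two ring class fields.
THE MECHANISM. (§1) an automorphism fixing `a` fixes `k⟮a⟯` pointwise; (§2) two automorphisms with the same values on `r_q, r_p` agree on every
point fixed by the joint stabiliser of `r_q, r_p`; (§3) TRANSPORT: if `σ̃ ∈ Aut(K[1]/ℚ)` fixes `F` pointwise and `g̃ ∈ Gal(F[1]/F)` has the same
complex value on the generator (`(σ̃ r_L : ℂ) = (g̃ r′ : ℂ)` where `(r_L : ℂ) = (r′ : ℂ)`), then for `X₁ ∈ X₀(49)(F[1])` fixed by
`Gal(F[1]/F(r′))` with `K[1]`-preimage `X^L` (`e_L X^L = e_{F[1]} X₁`): **`e_L(σ̃X^L) = e_{F[1]}(g̃X₁)`** — descend `X₁` to `F⟮r′⟯`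
(`exists_map_adjoin_eq_of_forall_fixing`), embed `F⟮r′⟯ ↪ K[1]` through `ℂ` (`algebraMap_adjoin_mem_of_mem`), and compare the two
`F`-algebra maps `F⟮r′⟯ → ℂ` on the power-basis generator (`PowerBasis.algHom_ext`).
HONEST FRAMING: field-theoretic plumbing; no Heegner point is shown non-torsion or non-divisible; items unchanged; BSD is not proved by any of this.

References: [Gross1984] §4; [Cox2013] §6.A Thm. 6.1 and §9.A; [SilvermanAEC2009] I.§1.
-/

noncomputable section

open scoped Classical IntermediateField

open WeierstrassCurve Literature.NumberTheory.EllipticCurves Literature.NumberTheory.EllipticCurves.ModularForms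

namespace Summit.BirchSwinnertonDyer.BirchSwinnertonDyer.Theorems.GoldfeldGoodTwists

/-! ## §1 An automorphism fixing `a` fixes `k⟮a⟯` pointwise -/
section FixAdjoin

variable {k : Type*} {L : Type*} [Field k] [Field L] [Algebra k L]

/-- If `t ∈ Aut(L/k)` fixes `a` then `t` fixes every element of `k⟮a⟯` (`k⟮a⟯ ≤ fixedField ⟨t⟩`). [folklore] -/
theorem apply_eq_self_of_mem_adjoin_simple (t : L ≃ₐ[k] L) {a : L} (ha : t a = a) {x : L} (hx : x ∈ k⟮a⟯) : t x = x := by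
  have hle : k⟮a⟯ ≤ IntermediateField.fixedField (Subgroup.zpowers t) := by
    rw [IntermediateField.adjoin_simple_le_iff, IntermediateField.mem_fixedField_iff]
    intro f hf
    have hst : Subgroup.zpowers t ≤ MulAction.stabilizer (L ≃ₐ[k] L) a :=
      (Subgroup.zpowers_le (G := L ≃ₐ[k] L)).mpr (MulAction.mem_stabilizer_iff.mpr (by rw [AlgEquiv.smul_def]; exact ha))
    have h := MulAction.mem_stabilizer_iff.mp (hst hf)
    rwa [AlgEquiv.smul_def] at h
  exact (IntermediateField.mem_fixedField_iff _ x).mp (hle hx) t (Subgroup.mem_zpowers t)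

end FixAdjoin

/-! ## §2 The action on a genus-fixed point depends only on the signs on `r_q, r_p` -/
section Signs

variable {k : Type*} {L : Type*} [Field k] [CharZero k] [Field L] [CharZero L] [Algebra k L]

/-- If `P ∈ X₀(49)(L)` is fixed by every `t ∈ Aut(L/k)` fixing `a` and `b`, then `t₁P = t₂P` whenever `t₁, t₂` agree on `a` and on `b`
(`t₂⁻¹t₁` fixes `a, b`). [folklore] -/
theorem map_eq_map_of_apply_eq (t₁ t₂ : L ≃ₐ[k] L) {a b : L} (ha : t₁ a = t₂ a) (hb : t₁ b = t₂ b)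
    {P : (cm7.baseChange L).toAffine.Point}
    (hP : ∀ t : L ≃ₐ[k] L, t a = a → t b = b → Affine.Point.map (t : L →ₐ[k] L) P = P) :
    Affine.Point.map (t₁ : L →ₐ[k] L) P = Affine.Point.map (t₂ : L →ₐ[k] L) P := by
  have h1 : (t₂⁻¹ * t₁) a = a := by
    rw [AlgEquiv.mul_apply, ha, ← AlgEquiv.mul_apply, inv_mul_cancel, AlgEquiv.one_apply]
  have h2 : (t₂⁻¹ * t₁) b = b := by
    rw [AlgEquiv.mul_apply, hb, ← AlgEquiv.mul_apply, inv_mul_cancel, AlgEquiv.one_apply]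
  have h := hP _ h1 h2
  have e : (t₁ : L →ₐ[k] L) = (t₂ : L →ₐ[k] L).comp ((t₂⁻¹ * t₁ : L ≃ₐ[k] L) : L →ₐ[k] L) := by
    ext x
    change t₁ x = t₂ ((t₂⁻¹ * t₁) x)
    rw [AlgEquiv.mul_apply, ← AlgEquiv.mul_apply t₂, mul_inv_cancel, AlgEquiv.one_apply]
  rw [e, ← Affine.Point.map_map, h]

end Signs

/-! ## §3 Transport from the partner field's Hilbert class field -/
section Transport

variable {K : Type} [Field K] [NumberField K] (ι : K →+* ℂ)
variable (F : Type) [Field F] [CharZero F] [Algebra F (ringClassField K ι 1)] (F₁ : Subfield ℂ) [Algebra F F₁]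
  [FiniteDimensional F F₁]
  [IsGalois F F₁]

set_option maxHeartbeats 400000 in
/-- **GENUS TRANSPORT.** `L = K[1] ⊂ ℂ`; `F` a field mapped into `L` and into a subfield `F₁ ⊂ ℂ` (`F₁/F` finite Galois — the partner
field's Hilbert class field) COMPATIBLY (`hcoe`: the two images of `a ∈ F` are the same complex number); `r′ ∈ F₁` and `r_L ∈ L` with the
same complex value; `σ̃ ∈ Aut(L/ℚ)` fixing `F` pointwise and `g̃ ∈ Gal(F₁/F)` with `(σ̃ r_L : ℂ) = (g̃ r′ : ℂ)`. If `X₁ ∈ X₀(49)(F₁)` is fixed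
by every `h ∈ Gal(F₁/F)` with `h r′ = r′`, and `X^L ∈ X₀(49)(L)` has `e_L X^L = e_{F₁} X₁`, then **`e_L(σ̃ X^L) = e_{F₁}(g̃ X₁)`** (descend `X₁`
to `F⟮r′⟯`, embed `F⟮r′⟯ ↪ L` through `ℂ`, compare the two `F`-algebra maps `F⟮r′⟯ → ℂ` on the power-basis generator).
[cite: Gross1984, §4] [cite: Cox2013, §6.A Thm. 6.1] -/
theorem map_subtype_map_eq_of_genusTransport
    (hcoe : ∀ a : F, ((algebraMap F F₁ a : F₁) : ℂ) = ((algebraMap F (ringClassField K ι 1) a : ringClassField K ι 1) : ℂ))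
    (r' : F₁) (rL : ringClassField K ι 1) (hr : (rL : ℂ) = (r' : ℂ))
    (σ : ringClassField K ι 1 ≃ₐ[ℚ] ringClassField K ι 1) (hσF : ∀ a : F, σ (algebraMap F (ringClassField K ι 1) a) = algebraMap F _ a)
    (g : F₁ ≃ₐ[F] F₁) (hσg : ((σ rL : ringClassField K ι 1) : ℂ) = ((g r' : F₁) : ℂ))
    (X₁ : (cm7.baseChange F₁).toAffine.Point) (hX₁ : ∀ h : F₁ ≃ₐ[F] F₁, h r' = r' → Affine.Point.map (h : F₁ →ₐ[F] F₁) X₁ = X₁)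
    (XL : (cm7.baseChange (ringClassField K ι 1)).toAffine.Point)
    (hXL : Affine.Point.map (W' := cm7) (ringClassField K ι 1).subtype.toRatAlgHom XL =
      Affine.Point.map (W' := cm7) F₁.subtype.toRatAlgHom X₁) :
    Affine.Point.map (W' := cm7) (ringClassField K ι 1).subtype.toRatAlgHom
        (Affine.Point.map (σ : ringClassField K ι 1 →ₐ[ℚ] ringClassField K ι 1) XL) =
      Affine.Point.map (W' := cm7) F₁.subtype.toRatAlgHom (Affine.Point.map (g : F₁ →ₐ[F] F₁) X₁) := by
  ------------------------------------------------------------------ descend `X₁` to `F⟮r′⟯`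
  obtain ⟨X₀, hX₀''⟩ := exists_map_adjoin_eq_of_forall_fixing cm7 (k := F) r' hX₁
  have hX₀ : Affine.Point.map (W' := cm7) (algebraMap F⟮r'⟯ F₁).toRatAlgHom X₀ = X₁ := by
    rw [← hX₀'']; cases X₀ <;> rfl
  ------------------------------------------------------------------ the embedding `j : F⟮r′⟯ → L` (through `ℂ`)
  have hF₀ : ∀ a : F, F₁.subtype (algebraMap F F₁ a) ∈ ringClassField K ι 1 := fun a ↦ by
    rw [Subfield.coe_subtype, hcoe]
    exact (algebraMap F (ringClassField K ι 1) a).2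
  have hrmem : F₁.subtype r' ∈ ringClassField K ι 1 := by rw [Subfield.coe_subtype, ← hr]; exact rL.2
  have hmem : ∀ x : F⟮r'⟯, (F₁.subtype.comp (algebraMap F⟮r'⟯ F₁)) x ∈ ringClassField K ι 1 := fun x ↦
    algebraMap_adjoin_mem_of_mem (F₀ := F) F₁.subtype (ringClassField K ι 1) hF₀ (r := r') hrmem x
  let j : F⟮r'⟯ →+* ringClassField K ι 1 := (F₁.subtype.comp (algebraMap F⟮r'⟯ F₁)).codRestrict (ringClassField K ι 1) hmem
  have hj : ∀ x : F⟮r'⟯, ((j x : ringClassField K ι 1) : ℂ) = ((algebraMap F⟮r'⟯ F₁ x : F₁) : ℂ) := fun _ ↦ rfl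
  -- `j` on the base `F` and on the generator
  have hjF : ∀ a : F, j (algebraMap F F⟮r'⟯ a) = algebraMap F (ringClassField K ι 1) a := fun a ↦ by
    apply Subtype.ext
    rw [hj, ← IsScalarTower.algebraMap_apply, hcoe]
  have hjr : j (IntermediateField.AdjoinSimple.gen F r') = rL := by
    apply Subtype.ext
    rw [hj, IntermediateField.AdjoinSimple.algebraMap_gen, hr]
  -- `map j X₀ = X^L` (compare in `X₀(49)(ℂ)`)
  have hjX : Affine.Point.map (W' := cm7) j.toRatAlgHom X₀ = XL := by
    apply Affine.Point.map_injective (W' := cm7) (f := (ringClassField K ι 1).subtype.toRatAlgHom)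
    have hc : (ringClassField K ι 1).subtype.toRatAlgHom.comp j.toRatAlgHom =
        F₁.subtype.toRatAlgHom.comp (algebraMap F⟮r'⟯ F₁).toRatAlgHom := AlgHom.ext fun x ↦ hj x
    rw [Affine.Point.map_map, hc, ← Affine.Point.map_map, hX₀, hXL]
  ------------------------------------------------------------------ the two `F`-algebra maps `F⟮r′⟯ → ℂ`
  letI : Algebra F ℂ := (F₁.subtype.comp (algebraMap F F₁)).toAlgebra
  have halg : ∀ a : F, algebraMap F ℂ a = ((algebraMap F F₁ a : F₁) : ℂ) := fun _ ↦ rfl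
  let φ₁ : F⟮r'⟯ →ₐ[F] ℂ :=
    { toRingHom := F₁.subtype.comp ((g : F₁ →+* F₁).comp (algebraMap F⟮r'⟯ F₁))
      commutes' := fun a ↦ by
        change ((g (algebraMap F⟮r'⟯ F₁ (algebraMap F F⟮r'⟯ a)) : F₁) : ℂ) = algebraMap F ℂ a
        rw [← IsScalarTower.algebraMap_apply, AlgEquiv.commutes, halg] }
  let φ₂ : F⟮r'⟯ →ₐ[F] ℂ :=
    { toRingHom := (ringClassField K ι 1).subtype.comp ((σ : ringClassField K ι 1 →+* ringClassField K ι 1).comp j)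
      commutes' := fun a ↦ by
        change ((σ (j (algebraMap F F⟮r'⟯ a)) : ringClassField K ι 1) : ℂ) = algebraMap F ℂ a
        rw [hjF, hσF, halg, hcoe] }
  have hint : IsIntegral F r' := Algebra.IsIntegral.isIntegral r'
  have hφ : φ₁ = φ₂ := by
    apply (IntermediateField.adjoin.powerBasis hint).algHom_ext
    rw [IntermediateField.adjoin.powerBasis_gen]
    change ((g (algebraMap F⟮r'⟯ F₁ (IntermediateField.AdjoinSimple.gen F r')) : F₁) : ℂ) =
      ((σ (j (IntermediateField.AdjoinSimple.gen F r')) : ringClassField K ι 1) : ℂ)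
    rw [IntermediateField.AdjoinSimple.algebraMap_gen, hjr, hσg]
  ------------------------------------------------------------------ conclude on points
  have hc₁ : F₁.subtype.toRatAlgHom.comp (((g : F₁ →ₐ[F] F₁) : F₁ →+* F₁).toRatAlgHom.comp (algebraMap F⟮r'⟯ F₁).toRatAlgHom) =
      φ₁.toRingHom.toRatAlgHom := AlgHom.ext fun _ ↦ rfl
  have hc₂ : (ringClassField K ι 1).subtype.toRatAlgHom.comp
      (((σ : ringClassField K ι 1 →ₐ[ℚ] ringClassField K ι 1) : ringClassField K ι 1 →+* ringClassField K ι 1).toRatAlgHom.comp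
        j.toRatAlgHom) = φ₂.toRingHom.toRatAlgHom := AlgHom.ext fun _ ↦ rfl
  have key : Affine.Point.map (W' := cm7) φ₁.toRingHom.toRatAlgHom X₀ =
      Affine.Point.map (W' := cm7) φ₂.toRingHom.toRatAlgHom X₀ := by rw [hφ]
  rw [← hc₁, ← hc₂, ← Affine.Point.map_map, ← Affine.Point.map_map, ← Affine.Point.map_map, ← Affine.Point.map_map, hjX] at key
  -- `key : e_{F₁} (map g (map incl X₀)) = e_L (map σ XL)` up to the coercions of `g`, `σ` to `ℚ`-algebra maps
  have eg : Affine.Point.map (W' := cm7) (((g : F₁ →ₐ[F] F₁) : F₁ →+* F₁).toRatAlgHom)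
      (Affine.Point.map (W' := cm7) (algebraMap F⟮r'⟯ F₁).toRatAlgHom X₀) = Affine.Point.map (g : F₁ →ₐ[F] F₁) X₁ := by
    rw [hX₀]; cases X₁ <;> rfl
  have eσ : Affine.Point.map (W' := cm7)
      (((σ : ringClassField K ι 1 →ₐ[ℚ] ringClassField K ι 1) : ringClassField K ι 1 →+* ringClassField K ι 1).toRatAlgHom) XL =
      Affine.Point.map (σ : ringClassField K ι 1 →ₐ[ℚ] ringClassField K ι 1) XL := by
    cases XL <;> rfl
  rw [eg, eσ] at key
  exact key.symm

end Transport

end Summit.BirchSwinnertonDyer.BirchSwinnertonDyer.Theorems.GoldfeldGoodTwists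

end
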